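/-
Copyright: the b2b-balaban T⁴-continuum CRUX team, row NE7b OWNER lineage `t4-ne7b-p1` (gen 124). Project licence.
-/
import Summits.QuantumFields.BalabanUV.T4Continuum.Spine.NE7b.SupZdResponseKernel
import Summits.QuantumFields.BalabanUV.T4Continuum.Spine.NE7b.SupZdCoarseLipschitz

/-!
# THE INFINITE-VOLUME NEXT-SCALE HESSIAN KERNEL IS LIPSCHITZ IN THE POTENTIAL, WITH DECAY: for `V₁, V₂ : ℤ^d → [−λ, Λ]` with
# `|V₁ − V₂| ≤ D` (`d ≥ 3`, every mesh), the inverses `M_i = T_∞[V_i]⁻¹` of (194)∕(195) satisfy `|M₁(b,b′) − M₂(b,b′)| ≤ C·D·e^{−δ|b − b′|₁}`,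
# `(C, δ)` from `(d, a, λ, Λ)` ONLY — the resolvent identity `M₁ − M₂ = M₁(T₂ − T₁)M₂` ON `ℤ^d` (two-sided inverse identities of (195) and
# one exchange of absolutely convergent double series), (192)'s Lipschitz bound for the entries `T₂ − T₁`, and two convolutions of
# exponentials ((200) §1); the infinite-volume twin of (192)∕(150) for the next-scale Hessian (row NE7b, node U5c; (186)∕(192)∕(194)∕(195)∕
# (200) BY NAME; [folklore])

Cell `pub-balaban`, sub-cell `t4`, spine estimate NE7b (`T4WeightBudget.RelWeightBound`; the cell's OWN estimate — NOT PRINTED in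
[Bałaban 1983–89], NOT PROVED).  Crux-route work under `Spine/NE7b/` by the row OWNER (`t4-ne7b-p1` gen 124, file (202)) under FREEZE
(0)'s crux-prover clause; NOTHING of Bałaban's is named as a Lean object, valued or asserted; no `T4Continuum/Support` leaf typed; no `def`,
no notation (`M₁, M₂` ANY kernels with (194)'s cube-limit property for `(V₁,Ψ₁)`, `(V₂,Ψ₂)`); zero `sorry`.  Imports (BY NAME): the OWNER's
(200) `…SupZdResponseKernel` (`tsum_exp_conv_le`; through it (195) `zd_coarse_mul_inverse`, `zd_coarse_inverse_mul`, (194)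
`zd_coarse_section_inverse`, (186) `zd_coarse_entry_decay`, (189), (191) `natAbs_sub_comm_sum`), (192) `…SupZdCoarseLipschitz`
(`zd_coarse_entry_lipschitz`), Mathlib's `summable_prod_of_nonneg`, `Summable.prod`, `Summable.prod_factor`, `Summable.tsum_comm`,
`Summable.tsum_sub`, `norm_tsum_le_tsum_norm`, `tsum_eq_single`.

WHY (located).  Smoothness of the RG map in the background field is, at the quadratic level, the Lipschitz dependence of the next-scale
Hessian on the potential `V = u″(φ)`; on the torus this is (150)∕(192)'s pattern through the finite resolvent identity.  On `ℤ^d` the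
identity `M₁ − M₂ = M₁(T₂ − T₁)M₂` needs: `M₁(b,b′) = Σ′_cM₁(b,c)δ_{cb′} = Σ′_cΣ′_{c′}M₁(b,c)T₂(c,c′)M₂(c′,b′)` (`T₂M₂ = 1`) and `M₂(b,b′) =
Σ′_{c′}δ_{bc′}M₂(c′,b′) = Σ′_{c′}Σ′_cM₁(b,c)T₁(c,c′)M₂(c′,b′)` (`M₁T₁ = 1`), the latter re-ordered by Fubini — legitimate because
`|M₁(b,c)T_i(c,c′)M₂(c′,b′)| ≤ c₁C_ec₁e^{−m(|b−c|₁ + |c−c′|₁ + |c′−b′|₁)}` is summable on `ℤ^d × ℤ^d` (§1: the inner convolution is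
`≤ K_{m∕2}e^{−(m∕2)|c−b′|₁}`, the outer `≤ K_{m∕4}e^{−(m∕4)|b−b′|₁}`); the same domination with `C_LD` in place of `C_e` ((192)) bounds the
difference.

WHAT IS PROVED ([folklore]; `X d = ℤ^d`): §1 **`double_conv`** (a family on `ℤ^d × ℤ^d` dominated by `Ae^{−m|b−c|₁}e^{−m|c−c′|₁}e^{−m|c′−b′|₁}`
is absolutely summable and `|Σ′_cΣ′_{c′}F| ≤ AK_{m∕2}K_{m∕4}e^{−(m∕4)|b−b′|₁}`); §2 **`zd_coarse_inverse_lipschitz`** (THE END: `∃ C δ > 0`: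
for ALL `n`, `V₁, V₂` of the class with `|V₁ − V₂| ≤ D`, block columns `Ψ₁, Ψ₂`, cube limits `M₁, M₂`: `|M₁(b,b′) − M₂(b,b′)| ≤
CDe^{−δ|b−b′|₁}`); §3 toy.

HONEST (what this is NOT).  Lipschitz dependence on the POTENTIAL only (the road's `V = u″(φ)` — composition with the Nemytskii map
(58)∕(171) is by name, not typed here); the LINEAR column only; `d ≥ 3` only; scalar skeleton ((A3), NC-NE7b-α UNRULED); nothing of the
covariant propagators of [B4]–[B6]; nothing of Bałaban's asserted.  BY-NAME EFFECT ON THE WALL: NONE.  NE7b NOT PRINTED ∕ NOT PROVED; spine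
PROVED 0∕9; rung (B)+1 — the programme's measures remain FINITE-torus statements; NOT the mass gap, NOT Clay.  HONEST DEPENDENCY:
continuum YM on T⁴ ⇐ BetaPertH ∧ nine spine estimates (0∕9 proved); BetaPertH ⇐ (D1) ∧ (D4) ∧ CAP+tail; G-an2-4 gates asym, D1 and NE2∕3∕4.
-/

set_option autoImplicit false

noncomputable section

namespace Summit.QuantumFields.BalabanUV.T4Continuum.NE7b.SupZdCoarseInverseLipschitz

open Real Filter Topology
open Literature.MathematicalPhysics.QuantumFieldTheory.Balaban1983to89
open B6QGQLower276 (X e blk B side chart mem_B sum_B sum_B_const card_cube blk_chart)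
open SupZdExponentialSums (summable_exp_l1 tsum_exp_l1_le)
open SupZdCoarseForm (natAbs_sub_comm_sum)
open SupZdCoarseOperator (zd_coarse_entry_decay)
open SupZdCoarseLipschitz (zd_coarse_entry_lipschitz)
open SupZdCoarseInverse (zd_coarse_section_inverse)
open SupZdCoarseInverseIdentities (zd_coarse_mul_inverse zd_coarse_inverse_mul)
open SupZdResponseKernel (tsum_exp_conv_le)

variable {d : ℕ}

/-! ## §1. A doubly exponentially dominated family on `ℤ^d × ℤ^d`: absolute convergence and the bound of its double series -/

/-- **DOUBLE CONVOLUTION**: `|F(c,c′)| ≤ A·e^{−m|b − c|₁}e^{−m|c − c′|₁}e^{−m|c′ − b′|₁}` ⟹ `F` is absolutely summable on `ℤ^d × ℤ^d` (so its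
iterated series exchange), and `|Σ′_cΣ′_{c′}F(c,c′)| ≤ A·K_{m∕2}·K_{m∕4}·e^{−(m∕4)|b − b′|₁}` — (200) `tsum_exp_conv_le` twice. [folklore] -/
theorem double_conv {m A : ℝ} (hm : 0 < m) (hA : 0 ≤ A) (b b' : X d) (F : X d → X d → ℝ)
    (hF : ∀ c c', |F c c'| ≤ A * exp (-(m * ∑ i, (((b i - c i).natAbs : ℕ) : ℝ)))
      * (exp (-(m * ∑ i, (((c' i - b' i).natAbs : ℕ) : ℝ))) * exp (-(m * ∑ i, (((c i - c' i).natAbs : ℕ) : ℝ))))) :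
    Summable (Function.uncurry F) ∧
    |∑' c : X d, ∑' c' : X d, F c c'| ≤ A * (2 * (1 - exp (-(m / 2)))⁻¹) ^ d * (2 * (1 - exp (-(m / 2 / 2)))⁻¹) ^ d
      * exp (-(m / 2 / 2 * ∑ i, (((b i - b' i).natAbs : ℕ) : ℝ))) := by
  classical
  have hm2 : 0 < m / 2 := by linarith
  set K₁ : ℝ := (2 * (1 - exp (-(m / 2)))⁻¹) ^ d with hK₁
  set K₂ : ℝ := (2 * (1 - exp (-(m / 2 / 2)))⁻¹) ^ d with hK₂
  have hK₁0 : 0 < K₁ := pow_pos (mul_pos two_pos (inv_pos.2 (sub_pos.2 (exp_lt_one_iff.2 (by linarith))))) d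
  -- the dominating family and its summability on the product
  set g : X d × X d → ℝ := fun p => A * exp (-(m * ∑ i, (((b i - p.1 i).natAbs : ℕ) : ℝ)))
    * (exp (-(m * ∑ i, (((p.2 i - b' i).natAbs : ℕ) : ℝ))) * exp (-(m * ∑ i, (((p.1 i - p.2 i).natAbs : ℕ) : ℝ)))) with hg
  have hg0 : 0 ≤ g := fun p => by simp only [hg]; positivity
  have hrow : ∀ c : X d, ∑' c' : X d, g (c, c') ≤ A * K₁ * exp (-(m * ∑ i, (((b i - c i).natAbs : ℕ) : ℝ))) := by
    intro c
    obtain ⟨hcs, hcb⟩ := tsum_exp_conv_le hm b' c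
    simp only [hg]
    rw [tsum_mul_left]
    have h1 : exp (-(m / 2 * ∑ i, (((c i - b' i).natAbs : ℕ) : ℝ))) ≤ 1 := exp_le_one_iff.2 (neg_nonpos.2 (by positivity))
    calc A * exp (-(m * ∑ i, (((b i - c i).natAbs : ℕ) : ℝ))) * ∑' c' : X d, exp (-(m * ∑ i, (((c' i - b' i).natAbs : ℕ) : ℝ)))
          * exp (-(m * ∑ i, (((c i - c' i).natAbs : ℕ) : ℝ)))
        ≤ A * exp (-(m * ∑ i, (((b i - c i).natAbs : ℕ) : ℝ))) * (K₁ * exp (-(m / 2 * ∑ i, (((c i - b' i).natAbs : ℕ) : ℝ)))) :=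
          mul_le_mul_of_nonneg_left hcb (by positivity)
      _ ≤ A * exp (-(m * ∑ i, (((b i - c i).natAbs : ℕ) : ℝ))) * (K₁ * 1) := by gcongr
      _ = _ := by ring
  have hgsum : Summable g := by
    refine (summable_prod_of_nonneg hg0).2 ⟨fun c => ?_, ?_⟩
    · simp only [hg]; exact (tsum_exp_conv_le hm b' c).1.mul_left _
    · exact Summable.of_nonneg_of_le (fun c => tsum_nonneg fun c' => hg0 (c, c')) hrow ((summable_exp_l1 hm b).mul_left (A * K₁))
  have hFsum : Summable (Function.uncurry F) :=
    Summable.of_norm_bounded hgsum fun p => by simp only [Function.uncurry, hg, Real.norm_eq_abs]; exact hF p.1 p.2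
  refine ⟨hFsum, ?_⟩
  -- the bound: `|Σ′_cΣ′_{c′}F| ≤ Σ′_c A K₁ e^{−m|b−c|} e^{−(m∕2)|c−b′|} ≤ A K₁ K₂ e^{−(m∕4)|b−b′|}`
  have hrowF : ∀ c : X d, |∑' c' : X d, F c c'| ≤ A * K₁ * (exp (-(m / 2 * ∑ i, (((c i - b i).natAbs : ℕ) : ℝ)))
      * exp (-(m / 2 * ∑ i, (((b' i - c i).natAbs : ℕ) : ℝ)))) := by
    intro c
    obtain ⟨hcs, hcb⟩ := tsum_exp_conv_le hm b' c
    have hs := hFsum.prod_factor c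
    have h1 : |∑' c' : X d, F c c'| ≤ ∑' c' : X d, |F c c'| := by
      have := norm_tsum_le_tsum_norm hs.norm
      simpa only [Real.norm_eq_abs, Function.uncurry] using this
    have h2 : ∑' c' : X d, |F c c'| ≤ ∑' c' : X d, g (c, c') := by
      refine Summable.tsum_le_tsum (fun c' => ?_) ?_ (hgsum.prod_factor c)
      · simpa only [hg] using hF c c'
      · have := hs.abs; simpa only [Function.uncurry] using this
    have h3 : ∑' c' : X d, g (c, c') ≤ A * exp (-(m * ∑ i, (((b i - c i).natAbs : ℕ) : ℝ)))
        * (K₁ * exp (-(m / 2 * ∑ i, (((c i - b' i).natAbs : ℕ) : ℝ)))) := by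
      simp only [hg]
      rw [tsum_mul_left]
      exact mul_le_mul_of_nonneg_left hcb (by positivity)
    have h4 : A * exp (-(m * ∑ i, (((b i - c i).natAbs : ℕ) : ℝ))) * (K₁ * exp (-(m / 2 * ∑ i, (((c i - b' i).natAbs : ℕ) : ℝ))))
        ≤ A * K₁ * (exp (-(m / 2 * ∑ i, (((c i - b i).natAbs : ℕ) : ℝ))) * exp (-(m / 2 * ∑ i, (((b' i - c i).natAbs : ℕ) : ℝ)))) := by
      rw [natAbs_sub_comm_sum b c, natAbs_sub_comm_sum c b']
      have e1 : exp (-(m * ∑ i, (((c i - b i).natAbs : ℕ) : ℝ))) ≤ exp (-(m / 2 * ∑ i, (((c i - b i).natAbs : ℕ) : ℝ))) :=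
        exp_le_exp.2 (by nlinarith [show (0:ℝ) ≤ ∑ i, (((c i - b i).natAbs : ℕ) : ℝ) by positivity])
      calc A * exp (-(m * ∑ i, (((c i - b i).natAbs : ℕ) : ℝ))) * (K₁ * exp (-(m / 2 * ∑ i, (((b' i - c i).natAbs : ℕ) : ℝ))))
          = A * K₁ * (exp (-(m * ∑ i, (((c i - b i).natAbs : ℕ) : ℝ))) * exp (-(m / 2 * ∑ i, (((b' i - c i).natAbs : ℕ) : ℝ)))) := by ring
        _ ≤ _ := by gcongr
    exact h1.trans (h2.trans (h3.trans h4))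
  obtain ⟨hcs2, hcb2⟩ := tsum_exp_conv_le hm2 b b'
  have h5 : |∑' c : X d, ∑' c' : X d, F c c'| ≤ ∑' c : X d, |∑' c' : X d, F c c'| := by
    have := norm_tsum_le_tsum_norm hFsum.prod.norm
    simpa only [Real.norm_eq_abs, Function.uncurry] using this
  have h6 : ∑' c : X d, |∑' c' : X d, F c c'| ≤ ∑' c : X d, A * K₁ * (exp (-(m / 2 * ∑ i, (((c i - b i).natAbs : ℕ) : ℝ)))
      * exp (-(m / 2 * ∑ i, (((b' i - c i).natAbs : ℕ) : ℝ)))) := by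
    refine Summable.tsum_le_tsum hrowF ?_ (hcs2.mul_left _)
    have := hFsum.prod.abs; simpa only [Function.uncurry] using this
  rw [Summable.tsum_mul_left _ hcs2] at h6
  have h7 := mul_le_mul_of_nonneg_left hcb2 (show 0 ≤ A * K₁ by positivity)
  rw [natAbs_sub_comm_sum b' b] at h7
  calc |∑' c : X d, ∑' c' : X d, F c c'| ≤ A * K₁ * (K₂ * exp (-(m / 2 / 2 * ∑ i, (((b i - b' i).natAbs : ℕ) : ℝ)))) :=
        h5.trans (h6.trans h7)
    _ = A * K₁ * K₂ * exp (-(m / 2 / 2 * ∑ i, (((b i - b' i).natAbs : ℕ) : ℝ))) := by ring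

/-! ## §2. THE END: the infinite-volume next-scale Hessian kernel is Lipschitz in the potential, with decay -/

/-- **HEADLINE — `|M₁(b,b′) − M₂(b,b′)| ≤ C·‖V₁ − V₂‖_∞·e^{−δ|b − b′|₁}`**: `d ≥ 3`, `a > 0`, `λ < min(2,a)`, `Λ ≥ 0` ⟹ `∃ C δ > 0` (from `(d, a, λ, Λ)`
ONLY) such that for ALL `n`, any two potentials `V₁, V₂ : ℤ^d → [−λ, Λ]` with `|V₁ − V₂| ≤ D`, ANY bounded block columns `Ψ₁, Ψ₂` of
`H_{V₁}, H_{V₂}` and ANY cube limits `M₁, M₂` of the section inverses of `T₁ = T_∞[V₁]`, `T₂ = T_∞[V₂]` ((194)): `|M₁(b,b′) − M₂(b,b′)| ≤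
C·D·e^{−δ|b − b′|₁}` — the RESOLVENT IDENTITY `M₁ − M₂ = M₁(T₂ − T₁)M₂` on `ℤ^d` ((195)'s `M₁T₁ = 1`, `T₂M₂ = 1`, §1's exchange), (192)
`zd_coarse_entry_lipschitz` for `T₂ − T₁`, and §1's bound. [folklore] -/
theorem zd_coarse_inverse_lipschitz (hd : 3 ≤ d) (a : ℝ) (ha : 0 < a) {lam Lam : ℝ} (hlam : lam < min 2 a) (hLam : 0 ≤ Lam) :
    ∃ C δ : ℝ, 0 < C ∧ 0 < δ ∧ ∀ (n : ℕ) (V₁ V₂ : X d → ℝ), (∀ p, -lam ≤ V₁ p) → (∀ p, V₁ p ≤ Lam) →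
      (∀ p, -lam ≤ V₂ p) → (∀ p, V₂ p ≤ Lam) → ∀ D : ℝ, (∀ p, |V₁ p - V₂ p| ≤ D) →
      ∀ (Ψ₁ Ψ₂ : X d → X d → ℝ) (B₁ B₂ : X d → ℝ), (∀ b' p, |Ψ₁ b' p| ≤ B₁ b') → (∀ b' p, |Ψ₂ b' p| ≤ B₂ b') →
      (∀ b' p, ((n : ℝ) + 1) ^ 2 * ∑ μ, (2 * Ψ₁ b' p - Ψ₁ b' (p + e μ) - Ψ₁ b' (p - e μ))
        + a / ((n : ℝ) + 1) ^ d * ∑ q ∈ B n (blk n p), Ψ₁ b' q + V₁ p * Ψ₁ b' p = if blk n p = b' then 1 else 0) →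
      (∀ b' p, ((n : ℝ) + 1) ^ 2 * ∑ μ, (2 * Ψ₂ b' p - Ψ₂ b' (p + e μ) - Ψ₂ b' (p - e μ))
        + a / ((n : ℝ) + 1) ^ d * ∑ q ∈ B n (blk n p), Ψ₂ b' q + V₂ p * Ψ₂ b' p = if blk n p = b' then 1 else 0) →
      ∀ (M₁ M₂ : X d → X d → ℝ),
      (∀ b b' : X d, Tendsto (fun R : ℕ =>
          if h : b ∈ (Fintype.piFinset fun _ : Fin d => Finset.Icc (-(R : ℤ)) R) ∧
              b' ∈ (Fintype.piFinset fun _ : Fin d => Finset.Icc (-(R : ℤ)) R)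
            then (Matrix.of fun c c' : ↥(Fintype.piFinset fun _ : Fin d => Finset.Icc (-(R : ℤ)) R) =>
              (((n : ℝ) + 1) ^ d)⁻¹ * ∑ q ∈ B n (c : X d), Ψ₁ (c' : X d) q)⁻¹ ⟨b, h.1⟩ ⟨b', h.2⟩ else 0)
        atTop (𝓝 (M₁ b b'))) →
      (∀ b b' : X d, Tendsto (fun R : ℕ =>
          if h : b ∈ (Fintype.piFinset fun _ : Fin d => Finset.Icc (-(R : ℤ)) R) ∧
              b' ∈ (Fintype.piFinset fun _ : Fin d => Finset.Icc (-(R : ℤ)) R)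
            then (Matrix.of fun c c' : ↥(Fintype.piFinset fun _ : Fin d => Finset.Icc (-(R : ℤ)) R) =>
              (((n : ℝ) + 1) ^ d)⁻¹ * ∑ q ∈ B n (c : X d), Ψ₂ (c' : X d) q)⁻¹ ⟨b, h.1⟩ ⟨b', h.2⟩ else 0)
        atTop (𝓝 (M₂ b b'))) →
      ∀ b b' : X d, |M₁ b b' - M₂ b b'| ≤ C * D * exp (-(δ * ∑ i, (((b i - b' i).natAbs : ℕ) : ℝ))) := by
  classical
  obtain ⟨CL, δL, hCL, hδL, H192⟩ := zd_coarse_entry_lipschitz (d := d) hd a ha hlam hLam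
  obtain ⟨Ce, δe, hCe, hδe, H186⟩ := zd_coarse_entry_decay (d := d) hd a ha hlam hLam
  obtain ⟨c₁, δ₁, hc₁, hδ₁, H4⟩ := zd_coarse_section_inverse (d := d) hd a ha hlam hLam
  set m : ℝ := min (min δL δ₁) δe with hm
  have hm0 : 0 < m := lt_min (lt_min hδL hδ₁) hδe
  have hmL : m ≤ δL := (min_le_left _ _).trans (min_le_left _ _)
  have hm1 : m ≤ δ₁ := (min_le_left _ _).trans (min_le_right _ _)
  have hme : m ≤ δe := min_le_right _ _
  set K : ℝ := (2 * (1 - exp (-(m / 2)))⁻¹) ^ d * (2 * (1 - exp (-(m / 2 / 2)))⁻¹) ^ d with hK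
  have hK0 : 0 < K := mul_pos (pow_pos (mul_pos two_pos (inv_pos.2 (sub_pos.2 (exp_lt_one_iff.2 (by linarith))))) d)
    (pow_pos (mul_pos two_pos (inv_pos.2 (sub_pos.2 (exp_lt_one_iff.2 (by linarith))))) d)
  refine ⟨c₁ * CL * c₁ * K, m / 2 / 2, by positivity, by positivity, ?_⟩
  intro n V₁ V₂ hV₁ hV₁' hV₂ hV₂' D hD Ψ₁ Ψ₂ B₁ B₂ hΨ₁B hΨ₂B hΨ₁ hΨ₂ M₁ M₂ hM₁ hM₂ b b'
  have hD0 : 0 ≤ D := (abs_nonneg _).trans (hD 0)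
  -- the kernels, abbreviated; a generic rate-`m` weakening
  obtain ⟨T₁, hT₁⟩ : ∃ T₁ : X d → X d → ℝ, ∀ c c', T₁ c c' = (((n : ℝ) + 1) ^ d)⁻¹ * ∑ q ∈ B n c, Ψ₁ c' q := ⟨_, fun _ _ => rfl⟩
  obtain ⟨T₂, hT₂⟩ : ∃ T₂ : X d → X d → ℝ, ∀ c c', T₂ c c' = (((n : ℝ) + 1) ^ d)⁻¹ * ∑ q ∈ B n c, Ψ₂ c' q := ⟨_, fun _ _ => rfl⟩
  have hweak : ∀ {x C δ : ℝ} (c c' : X d), 0 ≤ C → m ≤ δ → |x| ≤ C * exp (-(δ * ∑ i, (((c i - c' i).natAbs : ℕ) : ℝ))) →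
      |x| ≤ C * exp (-(m * ∑ i, (((c i - c' i).natAbs : ℕ) : ℝ))) := fun c c' hC hδ h =>
    h.trans (mul_le_mul_of_nonneg_left (exp_le_exp.2 (by
      nlinarith [show (0:ℝ) ≤ ∑ i, (((c i - c' i).natAbs : ℕ) : ℝ) by positivity])) hC)
  -- decay of `M₁`, `M₂`, `T₁`, `T₂` and the Lipschitz bound for `T₂ − T₁`, all at rate `m`
  have hM₁d : ∀ c c', |M₁ c c'| ≤ c₁ * exp (-(m * ∑ i, (((c i - c' i).natAbs : ℕ) : ℝ))) := fun c c' =>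
    hweak c c' hc₁.le hm1 (le_of_tendsto' (hM₁ c c').abs fun R => by
      split_ifs with h
      · exact (H4 n V₁ hV₁ hV₁' Ψ₁ B₁ hΨ₁B hΨ₁ _ _ (Finset.Subset.refl _)).1 ⟨c, h.1⟩ ⟨c', h.2⟩
      · rw [abs_zero]; positivity)
  have hM₂d : ∀ c c', |M₂ c c'| ≤ c₁ * exp (-(m * ∑ i, (((c i - c' i).natAbs : ℕ) : ℝ))) := fun c c' =>
    hweak c c' hc₁.le hm1 (le_of_tendsto' (hM₂ c c').abs fun R => by
      split_ifs with h
      · exact (H4 n V₂ hV₂ hV₂' Ψ₂ B₂ hΨ₂B hΨ₂ _ _ (Finset.Subset.refl _)).1 ⟨c, h.1⟩ ⟨c', h.2⟩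
      · rw [abs_zero]; positivity)
  have hT₁d : ∀ c c', |T₁ c c'| ≤ Ce * exp (-(m * ∑ i, (((c i - c' i).natAbs : ℕ) : ℝ))) := fun c c' =>
    hweak c c' hCe.le hme (by rw [hT₁]; exact H186 n V₁ hV₁ hV₁' Ψ₁ B₁ hΨ₁B hΨ₁ c c')
  have hT₂d : ∀ c c', |T₂ c c'| ≤ Ce * exp (-(m * ∑ i, (((c i - c' i).natAbs : ℕ) : ℝ))) := fun c c' =>
    hweak c c' hCe.le hme (by rw [hT₂]; exact H186 n V₂ hV₂ hV₂' Ψ₂ B₂ hΨ₂B hΨ₂ c c')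
  have hTd : ∀ c c', |T₂ c c' - T₁ c c'| ≤ CL * D * exp (-(m * ∑ i, (((c i - c' i).natAbs : ℕ) : ℝ))) := fun c c' =>
    hweak c c' (by positivity) hmL (by
      rw [abs_sub_comm, hT₁, hT₂]; exact H192 n V₁ V₂ hV₁ hV₁' hV₂ hV₂' D hD Ψ₁ Ψ₂ B₁ B₂ hΨ₁B hΨ₂B hΨ₁ hΨ₂ c c')
  -- the three triple-product families are doubly dominated (§1)
  have htriple : ∀ (T : X d → X d → ℝ) (CT : ℝ), 0 ≤ CT → (∀ c c', |T c c'| ≤ CT * exp (-(m * ∑ i, (((c i - c' i).natAbs : ℕ) : ℝ)))) →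
      ∀ c c', |M₁ b c * T c c' * M₂ c' b'| ≤ c₁ * CT * c₁ * exp (-(m * ∑ i, (((b i - c i).natAbs : ℕ) : ℝ)))
        * (exp (-(m * ∑ i, (((c' i - b' i).natAbs : ℕ) : ℝ))) * exp (-(m * ∑ i, (((c i - c' i).natAbs : ℕ) : ℝ)))) := by
    intro T CT hCT hT c c'
    rw [abs_mul, abs_mul]
    calc |M₁ b c| * |T c c'| * |M₂ c' b'| ≤ (c₁ * exp (-(m * ∑ i, (((b i - c i).natAbs : ℕ) : ℝ))))
          * (CT * exp (-(m * ∑ i, (((c i - c' i).natAbs : ℕ) : ℝ)))) * (c₁ * exp (-(m * ∑ i, (((c' i - b' i).natAbs : ℕ) : ℝ)))) :=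
          mul_le_mul (mul_le_mul (hM₁d b c) (hT c c') (abs_nonneg _) (by positivity)) (hM₂d c' b') (abs_nonneg _) (by positivity)
      _ = _ := by ring
  obtain ⟨hF₁, -⟩ := double_conv hm0 (show 0 ≤ c₁ * Ce * c₁ by positivity) b b' (fun c c' => M₁ b c * T₁ c c' * M₂ c' b')
    (htriple T₁ Ce hCe.le hT₁d)
  obtain ⟨hF₂, -⟩ := double_conv hm0 (show 0 ≤ c₁ * Ce * c₁ by positivity) b b' (fun c c' => M₁ b c * T₂ c c' * M₂ c' b')
    (htriple T₂ Ce hCe.le hT₂d)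
  obtain ⟨hFΔ, hbd⟩ := double_conv hm0 (show 0 ≤ c₁ * (CL * D) * c₁ by positivity) b b'
    (fun c c' => M₁ b c * (T₂ c c' - T₁ c c') * M₂ c' b') (htriple (fun c c' => T₂ c c' - T₁ c c') (CL * D) (by positivity) hTd)
  -- (195): `T₂M₂ = 1`, `M₁T₁ = 1`
  have hTM : ∀ c, ∑' c' : X d, T₂ c c' * M₂ c' b' = if c = b' then 1 else 0 := by
    intro c; simp only [hT₂]; exact (zd_coarse_mul_inverse hd a ha hlam hLam n V₂ hV₂ hV₂' Ψ₂ B₂ hΨ₂B hΨ₂ M₂ hM₂ c b').2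
  have hMT : ∀ c', ∑' c : X d, M₁ b c * T₁ c c' = if b = c' then 1 else 0 := by
    intro c'; simp only [hT₁]; exact (zd_coarse_inverse_mul hd a ha hlam hLam n V₁ hV₁ hV₁' Ψ₁ B₁ hΨ₁B hΨ₁ M₁ hM₁ b c').2
  -- the resolvent identity
  have e1 : M₁ b b' = ∑' c : X d, ∑' c' : X d, M₁ b c * T₂ c c' * M₂ c' b' := by
    calc M₁ b b' = ∑' c : X d, M₁ b c * (if c = b' then 1 else 0) := by
          rw [tsum_eq_single b' (fun c hc => by rw [if_neg hc, mul_zero]), if_pos rfl, mul_one]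
      _ = ∑' c : X d, M₁ b c * ∑' c' : X d, T₂ c c' * M₂ c' b' := tsum_congr fun c => by rw [hTM c]
      _ = _ := tsum_congr fun c => by rw [← tsum_mul_left]; exact tsum_congr fun c' => by ring
  have e2 : M₂ b b' = ∑' c : X d, ∑' c' : X d, M₁ b c * T₁ c c' * M₂ c' b' := by
    calc M₂ b b' = ∑' c' : X d, (if b = c' then 1 else 0) * M₂ c' b' := by
          rw [tsum_eq_single b (fun c' hc' => by rw [if_neg (Ne.symm hc'), zero_mul]), if_pos rfl, one_mul]
      _ = ∑' c' : X d, (∑' c : X d, M₁ b c * T₁ c c') * M₂ c' b' := tsum_congr fun c' => by rw [hMT c']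
      _ = ∑' c' : X d, ∑' c : X d, M₁ b c * T₁ c c' * M₂ c' b' := tsum_congr fun c' => by rw [← tsum_mul_right]
      _ = _ := hF₁.tsum_comm
  have hF₁o : Summable fun c : X d => ∑' c' : X d, M₁ b c * T₁ c c' * M₂ c' b' := by
    simpa only [Function.uncurry] using hF₁.prod
  have hF₂o : Summable fun c : X d => ∑' c' : X d, M₁ b c * T₂ c c' * M₂ c' b' := by
    simpa only [Function.uncurry] using hF₂.prod
  have hF₁i : ∀ c : X d, Summable fun c' : X d => M₁ b c * T₁ c c' * M₂ c' b' := fun c => by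
    simpa only [Function.uncurry] using hF₁.prod_factor c
  have hF₂i : ∀ c : X d, Summable fun c' : X d => M₁ b c * T₂ c c' * M₂ c' b' := fun c => by
    simpa only [Function.uncurry] using hF₂.prod_factor c
  have e3 : M₁ b b' - M₂ b b' = ∑' c : X d, ∑' c' : X d, M₁ b c * (T₂ c c' - T₁ c c') * M₂ c' b' := by
    rw [e1, e2, ← hF₂o.tsum_sub hF₁o]
    refine tsum_congr fun c => ?_
    rw [← (hF₂i c).tsum_sub (hF₁i c)]
    exact tsum_congr fun c' => by ring
  rw [e3]
  calc |∑' c : X d, ∑' c' : X d, M₁ b c * (T₂ c c' - T₁ c c') * M₂ c' b'|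
      ≤ c₁ * (CL * D) * c₁ * (2 * (1 - exp (-(m / 2)))⁻¹) ^ d * (2 * (1 - exp (-(m / 2 / 2)))⁻¹) ^ d
          * exp (-(m / 2 / 2 * ∑ i, (((b i - b' i).natAbs : ℕ) : ℝ))) := hbd
    _ = c₁ * CL * c₁ * K * D * exp (-(m / 2 / 2 * ∑ i, (((b i - b' i).natAbs : ℕ) : ℝ))) := by rw [hK]; ring

/-! ## §3. Toy -/

/-- Toy (`d = 2`, `m = 1`): the zero family on `ℤ² × ℤ²` is doubly dominated, hence absolutely summable. -/
example : Summable (Function.uncurry fun _ _ : X 2 => (0 : ℝ)) :=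
  (double_conv (d := 2) one_pos le_rfl 0 0 (fun _ _ => 0) (fun c c' => by rw [abs_zero]; positivity)).1

end Summit.QuantumFields.BalabanUV.T4Continuum.NE7b.SupZdCoarseInverseLipschitz
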